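import Literature.NumberTheory.GaloisCohomology.PoitouTateSelmerStructuresRealPlaces
import Literature.NumberTheory.GaloisCohomology.ArchimedeanInvariantMap
import Literature.NumberTheory.GaloisRepresentations.ArchimedeanLocalDuality
import Literature.NumberTheory.GaloisRepresentations.LocalGlobalCohomologyFiniteProofs
import Literature.NumberTheory.EllipticCurves.ArchimedeanKummerImageMaximal
import Summits.BirchSwinnertonDyer.Rank1Residual.X11b.PerfectPairingAnnihilators
import HarnessLib

/-!
# Poitou–Tate toolkit (1/3): annihilators of meets, sums of perfect pairings, and local Tate duality at
# EVERY place of a number field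

Seat `bsd-schneider-door-c6`, gen 5 (cell `bsd-schneider-ideate`; crux `AnticycControlAdditiveK`,
stmt-BirchSwinnertonDyer-19295, route `SchneiderFreeAdditiveX3`).  THEOREMS ONLY (no definition, no named
fact, no `sorry`).  File 1 of 3 of the reduction of the conjunct `SelmerComplement` (Howard 2004
Thm. 2.1.11) of the named fact `poitouTate_selmerStructure_duality` — the one ingredient of that fact not
proved in the tree, on which the registered stubs `stub_baseCountTors` / `stub_ptSurj` / `stub_coinv` of
crux 19295 hinge — to Milne's basic middle exactness `Ker γ¹ ⊆ Im β¹` (*ADT* I Thm. 4.10(b)); see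
`SchneiderFreeAdditiveX3PoitouTateSelmerComplementReduction.lean` (2/3) and `…Canonical.lean` (3/3).
HONEST FRAMING: tools of finite duality and local Galois cohomology; proves no case of BSD.

* §1 finite duality (complements to X11b `FiniteDuality`): for a perfect pairing of finite groups killed
  by `n`, **`{}^⊥(B' ⊓ B'') = {}^⊥B' ⊔ {}^⊥B''`** and `(A' ⊓ A'')^⊥ = A'^⊥ ⊔ A''^⊥` (`annLeft_inf`,
  `annRight_inf`; Milne I Prop. 0.19); the SUM PAIRING `b(p,q) = ∑ᵢ eᵢ(pᵢ,qᵢ)` of a finite family of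
  pairings (`exists_piPairing` — the pairing `P¹_S(K, M) × P¹_S(K, M^D) → ℤ/n` of Milne I §4), its adjoints
  injective when those of the `eᵢ` are (`piPairing_injective`, `piPairing_flip_injective`), and the
  annihilators of product subgroups (`annRight_pi`, `annLeft_pi`).
* §2 **local Tate duality at EVERY place** (`bijective_localTatePairingZMod_place`): for a family of local
  invariant maps perfect at the finite places (`IsPerfect`, Milne I Cor. 2.3) and injective at the real
  places (`InjectiveAtRealPlaces`, Milne I Ex. 1.6 (c)), both adjoints of `inv_v(· ∪ ·)` on
  `H¹(K_v, M) × H¹(K_v, M^D)` are bijective at every place `v` (real places: the tree's Milne I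
  Thm. 2.13 (a) `bijective_localTatePairingZMod_inl`; complex places: `Γ_{K_w} = 1`, both groups vanish);
  `H¹(K_v, M)`, `H¹(K_v, M^D)` are finite at every place.

References: [MilneADT2006] I Prop. 0.19, Cor. 2.3, Thm. 2.13 (a), Ex. 1.6 (c), §4;
[Howard2004HeegnerKolyvagin] Thm. 2.1.11 (arXiv:1202.6340 p. 6).
-/

noncomputable section

open Function NumberField IsDedekindDomain
open scoped NumberField

universe u

set_option linter.dupNamespace false

namespace Summit.BirchSwinnertonDyer.BirchSwinnertonDyer.Theorems.SchneiderFreeAdditiveX3.PoitouTateReduction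

open Summit.BirchSwinnertonDyer.Rank1Residual.X11b.FiniteDuality

/-! ## §1. Finite duality: annihilators of meets, and finite products of perfect pairings -/

section FiniteDuality

variable {A : Type*} [AddCommGroup A] {B : Type*} [AddCommGroup B] {n : ℕ}

/-- **`{}^⊥(B' ⊓ B'') = {}^⊥B' ⊔ {}^⊥B''`** for a perfect pairing of finite groups killed by `n`
(annihilator of a meet is the join of the annihilators: `B' ⊓ B'' = ({}^⊥B' ⊔ {}^⊥B'')^⊥` by the double
annihilator, Milne *ADT* I Prop. 0.19). [folklore] -/
theorem annLeft_inf [Finite A] [Finite B] [NeZero n] (hA : ∀ x : A, n • x = 0) (hB : ∀ y : B, n • y = 0)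
    (b : A →+ B →+ ZMod n) (hb : Bijective b) (hflip : Bijective b.flip) (B' B'' : AddSubgroup B) :
    annLeft b (B' ⊓ B'') = annLeft b B' ⊔ annLeft b B'' := by
  conv_lhs => rw [← annRight_annLeft hA hB b hb hflip B', ← annRight_annLeft hA hB b hb hflip B'',
    ← annRight_sup]
  exact annLeft_annRight hA hB b hb hflip _

/-- **`(A' ⊓ A'')^⊥ = A'^⊥ ⊔ A''^⊥`** for a perfect pairing of finite groups killed by `n`. [folklore] -/
theorem annRight_inf [Finite A] [Finite B] [NeZero n] (hA : ∀ x : A, n • x = 0) (hB : ∀ y : B, n • y = 0)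
    (b : A →+ B →+ ZMod n) (hb : Bijective b) (hflip : Bijective b.flip) (A' A'' : AddSubgroup A) :
    annRight b (A' ⊓ A'') = annRight b A' ⊔ annRight b A'' := by
  conv_lhs => rw [← annLeft_annRight hA hB b hb hflip A', ← annLeft_annRight hA hB b hb hflip A'',
    ← annLeft_sup]
  exact annRight_annLeft hA hB b hb hflip _

end FiniteDuality

section PiPairing

variable {ι : Type*} [Fintype ι] [DecidableEq ι] {A B : ι → Type*} [∀ i, AddCommGroup (A i)]
  [∀ i, AddCommGroup (B i)] {n : ℕ}

omit [DecidableEq ι] in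
/-- **The sum pairing of a finite family of pairings** `b(p, q) = ∑ᵢ eᵢ(pᵢ, qᵢ)` on `Πᵢ Aᵢ × Πᵢ Bᵢ`
exists as a bi-additive map (the pairing on `⊕_{v ∈ S} H¹(K_v, M) × ⊕_{v ∈ S} H¹(K_v, M^D)` of Milne I §4,
`P¹_S(K, M) × P¹_S(K, M^D) → ℤ/n`). [folklore] -/
theorem exists_piPairing (e : ∀ i, A i →+ B i →+ ZMod n) :
    ∃ b : (Π i, A i) →+ (Π i, B i) →+ ZMod n, ∀ p q, b p q = ∑ i, e i (p i) (q i) := by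
  refine ⟨∑ i, ((e i).comp (Pi.evalAddMonoidHom A i)).compl₂ (Pi.evalAddMonoidHom B i), fun p q => ?_⟩
  rw [AddMonoidHom.finsetSum_apply, AddMonoidHom.finsetSum_apply]
  rfl

variable {e : ∀ i, A i →+ B i →+ ZMod n} {b : (Π i, A i) →+ (Π i, B i) →+ ZMod n}

/-- Value of the sum pairing on a vector supported at one index (right). [folklore] -/
theorem piPairing_single_right (hb : ∀ p q, b p q = ∑ i, e i (p i) (q i)) (p : Π i, A i) (i : ι)
    (y : B i) : b p (Pi.single i y) = e i (p i) y := by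
  rw [hb, Finset.sum_eq_single i]
  · rw [Pi.single_eq_same]
  · intro j _ hj
    rw [Pi.single_eq_of_ne hj, map_zero]
  · intro h
    exact absurd (Finset.mem_univ i) h

/-- Value of the sum pairing on a vector supported at one index (left). [folklore] -/
theorem piPairing_single_left (hb : ∀ p q, b p q = ∑ i, e i (p i) (q i)) (i : ι) (x : A i)
    (q : Π i, B i) : b (Pi.single i x) q = e i x (q i) := by
  rw [hb, Finset.sum_eq_single i]
  · rw [Pi.single_eq_same]
  · intro j _ hj
    rw [Pi.single_eq_of_ne hj, map_zero, AddMonoidHom.zero_apply]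
  · intro h
    exact absurd (Finset.mem_univ i) h

/-- The left adjoint of a sum of pairings with injective left adjoints is injective. [folklore] -/
theorem piPairing_injective (hb : ∀ p q, b p q = ∑ i, e i (p i) (q i))
    (hinj : ∀ i, Injective (e i)) : Injective b := by
  refine (injective_iff_map_eq_zero b).mpr fun p hp => funext fun i => ?_
  refine (injective_iff_map_eq_zero (e i)).mp (hinj i) (p i) (AddMonoidHom.ext fun y => ?_)
  rw [← piPairing_single_right hb p i y, hp, AddMonoidHom.zero_apply, AddMonoidHom.zero_apply]

/-- The right adjoint of a sum of pairings with injective right adjoints is injective. [folklore] -/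
theorem piPairing_flip_injective (hb : ∀ p q, b p q = ∑ i, e i (p i) (q i))
    (hinj : ∀ i, Injective (e i).flip) : Injective b.flip := by
  refine (injective_iff_map_eq_zero b.flip).mpr fun q hq => funext fun i => ?_
  refine (injective_iff_map_eq_zero (e i).flip).mp (hinj i) (q i) (AddMonoidHom.ext fun x => ?_)
  rw [AddMonoidHom.flip_apply, ← piPairing_single_left hb i x q, ← AddMonoidHom.flip_apply b, hq,
    AddMonoidHom.zero_apply, AddMonoidHom.zero_apply]

/-- **The right annihilator of a product subgroup is the product of the right annihilators.**
[folklore] -/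
theorem annRight_pi (hb : ∀ p q, b p q = ∑ i, e i (p i) (q i)) (T : ∀ i, AddSubgroup (A i)) :
    annRight b (AddSubgroup.pi Set.univ T) = AddSubgroup.pi Set.univ fun i => annRight (e i) (T i) := by
  ext q
  simp only [mem_annRight_iff, AddSubgroup.mem_pi, Set.mem_univ, true_imp_iff]
  constructor
  · intro h i x hx
    rw [← piPairing_single_left hb i x q]
    refine h _ fun j => ?_
    by_cases hj : j = i
    · subst hj; rw [Pi.single_eq_same]; exact hx
    · rw [Pi.single_eq_of_ne hj]; exact zero_mem _
  · intro h p hp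
    rw [hb]
    exact Finset.sum_eq_zero fun i _ => h i (p i) (hp i)

/-- **The left annihilator of a product subgroup is the product of the left annihilators.**
[folklore] -/
theorem annLeft_pi (hb : ∀ p q, b p q = ∑ i, e i (p i) (q i)) (U : ∀ i, AddSubgroup (B i)) :
    annLeft b (AddSubgroup.pi Set.univ U) = AddSubgroup.pi Set.univ fun i => annLeft (e i) (U i) := by
  ext p
  simp only [mem_annLeft_iff, AddSubgroup.mem_pi, Set.mem_univ, true_imp_iff]
  constructor
  · intro h i y hy
    rw [← piPairing_single_right hb p i y]
    refine h _ fun j => ?_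
    by_cases hj : j = i
    · subst hj; rw [Pi.single_eq_same]; exact hy
    · rw [Pi.single_eq_of_ne hj]; exact zero_mem _
  · intro h q hq
    rw [hb]
    exact Finset.sum_eq_zero fun i _ => h i (q i) (hq i)

omit [Fintype ι] [DecidableEq ι] in
/-- The product of groups killed by `n` is killed by `n`. [folklore] -/
theorem pi_nsmul_eq_zero (hA : ∀ i (x : A i), n • x = 0) (p : Π i, A i) : n • p = 0 :=
  funext fun i => by rw [Pi.smul_apply, Pi.zero_apply, hA i]

end PiPairing

/-! ## §2. Local Tate duality at EVERY place for a family perfect at the finite places and injective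
at the real places -/

section LocalPerfect

open Field
open Literature.NumberTheory.GaloisRepresentations Literature.NumberTheory.GaloisCohomology
open Literature.NumberTheory.GaloisRepresentations.DiscreteGaloisModule (mu localTatePairingZMod
  tateDual SelmerStructure unramifiedSubgroup)

variable {K : Type u} [Field K] [NumberField K] {n : ℕ} [NeZero n]
variable {M : Type u} [AddCommGroup M] [TopologicalSpace M] [DiscreteTopology M] [Finite M]

omit [NeZero n] in
/-- `H¹(K_v, M)` is finite at EVERY place `v` of a number field (finite `M`): at the finite places the
tree's `finite_galoisCohomology_one_toLocal` (Milne I Cor. 2.3), at the infinite places `Γ_{K_v}` is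
finite. [cite: MilneADT2006, Ch. I, Cor. 2.3 and Thm. 2.13] -/
theorem finite_galoisCohomology_one_toLocal_place (ρ : DiscreteGaloisModule K M) (v : Place K) :
    Finite (galoisCohomology (ρ.toLocal v) 1) := by
  rcases v with w | v
  · haveI := finite_absoluteGaloisGroup_placeCompletion_inl K w
    exact finite_galoisCohomology_one_of_finite_absoluteGaloisGroup (ρ.toLocal (Sum.inl w))
  · exact finite_galoisCohomology_one_toLocal ρ v

/-- `H¹(K_v, M^D)` is finite at every place. [cite: MilneADT2006, Ch. I, Cor. 2.3 and Thm. 2.13] -/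
theorem finite_galoisCohomology_one_tateDual_toLocal_place (ρ : DiscreteGaloisModule K M)
    (v : Place K) : Finite (galoisCohomology ((ρ.tateDual n).toLocal v) 1) :=
  haveI := DiscreteGaloisModule.TateDual.finite K M n
  finite_galoisCohomology_one_toLocal_place (ρ.tateDual n) v

/-- **Local Tate duality at every place.**  For a family of local invariant maps which is perfect at
the finite places (`IsPerfect`, Milne I Cor. 2.3) and injective at the real places
(`InjectiveAtRealPlaces`, Milne I Ex. 1.6 (c) with Thm. 2.13 (a)), both adjoints of
`⟨·, ·⟩_v = inv_v (· ∪ ·) : H¹(K_v, M) × H¹(K_v, M^D) → ℤ/n` are bijective at EVERY place `v` (at a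
complex place both groups vanish). [cite: MilneADT2006, Ch. I, Cor. 2.3 and Thm. 2.13 (a)] -/
theorem bijective_localTatePairingZMod_place (inv : LocalInvariants K n) (hperf : inv.IsPerfect)
    (hreal : inv.InjectiveAtRealPlaces) (ρ : DiscreteGaloisModule K M) (hM : ∀ m : M, n • m = 0)
    (v : Place K) :
    Bijective (localTatePairingZMod ρ n v (inv v)) ∧
      Bijective (localTatePairingZMod ρ n v (inv v)).flip := by
  rcases v with w | v
  · rcases w.isReal_or_isComplex with hw | hw
    · exact bijective_localTatePairingZMod_inl ρ n hM w (inv (Sum.inl w)) (hreal.injective hw)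
    · haveI : Subsingleton (absoluteGaloisGroup (Place.Completion (K := K) (Sum.inl w))) :=
        ⟨fun a c => (eq_one_absoluteGaloisGroup_of_isComplex hw a).trans
          (eq_one_absoluteGaloisGroup_of_isComplex hw c).symm⟩
      have hx : ∀ x : galoisCohomology (ρ.toLocal (Sum.inl w)) 1, x = 0 :=
        galoisCohomology_one_eq_zero_of_subsingleton _
      have hy : ∀ y : galoisCohomology ((ρ.tateDual n).toLocal (Sum.inl w)) 1, y = 0 :=
        galoisCohomology_one_eq_zero_of_subsingleton _
      refine ⟨⟨fun a c _ => (hx a).trans (hx c).symm, fun f => ⟨0, ?_⟩⟩,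
        ⟨fun a c _ => (hy a).trans (hy c).symm, fun f => ⟨0, ?_⟩⟩⟩
      · rw [map_zero]
        exact AddMonoidHom.ext fun y => by rw [hy y, map_zero, map_zero]
      · rw [map_zero]
        exact AddMonoidHom.ext fun x => by rw [hx x, map_zero, map_zero]
  · exact (hperf v).2 ρ hM

end LocalPerfect

end Summit.BirchSwinnertonDyer.BirchSwinnertonDyer.Theorems.SchneiderFreeAdditiveX3.PoitouTateReduction

end
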